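import Summits.ResolutionOfSingularities.ResolutionOfSingularities.Theorems.WeightedInvariantWeightedThesisHypersurfaceModelAssembly
import Summits.ResolutionOfSingularities.ResolutionOfSingularities.Theorems.WeightedInvariantWeightedThesisFunctionFieldKaehler
import Summits.ResolutionOfSingularities.ResolutionOfSingularities.Theorems.WeightedInvariantWeightedThesisFormFnGenerates
import Summits.ResolutionOfSingularities.ResolutionOfSingularities.Theorems.WeightedInvariantWeightedThesisGenericFormsNoCommonZero

/-!
# `WeightedInvariant.WeightedThesis`, line `datum-glued-split`, stub 5a: hypersurface models over
# infinite perfect fields (registered shape, closed)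

Crux `WeightedThesis` (stmt-ResolutionOfSingularities-0569), lead a1, RESHAPE 3 (2026-08-17). The
registered stub `stub_hypersurfaceModel_infinite`, PROVED: the glue `hypersurfaceModel_infinite_of_stubs`
(file …HypersurfaceModelAssembly) fed with the three landed sub-stubs `stub_functionFieldKaehler`
(`dim Ω[K(X)⁄k] = dim X`, `k` perfect), `stub_formFnLinearGenerates` (ratios of linear forms generate
`K(X)`) and `stub_genericFormsNoCommonZero` (sequentially generic linear forms without common zero).
Every integral closed `X ⊆ ℙⁿ_k` over an infinite perfect field `k` admits a finite birational
morphism onto an integral hypersurface (locally principal ideal sheaf) of a smooth separated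
quasi-compact `k`-scheme (`ℙ^{dim X + 1} ∖ {vertex}`): the generic linear projection.
[Kollár 2007, proof of Prop. 2.48; Hartshorne I Prop. 4.9]
-/

noncomputable section

set_option linter.dupNamespace false -- mandated namespace of this single-conjunct summit

namespace Summit.ResolutionOfSingularities.ResolutionOfSingularities.Theorems.WeightedThesis.HypersurfaceModel

/-- **Hypersurface models over infinite perfect fields** (registered stub 5a of line
`datum-glued-split`): every integral closed subscheme `X` of `ℙⁿ_k`, `k` an infinite perfect field,
admits a finite birational morphism `φ : X → H` onto an integral closed subscheme `H` with locally
principal ideal sheaf of a smooth separated quasi-compact `k`-scheme `Y`.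
[cite: Kollar2007, Prop. 2.48 (proof); Hartshorne1977, I Prop. 4.9] -/
theorem stub_hypersurfaceModel_infinite :
    ∀ (k : Type) [Field k] [PerfectField k] [Infinite k] (n : ℕ) (X : AlgebraicGeometry.Scheme.{0}) (ι : X ⟶ (Literature.AlgebraicGeometry.Motives.projectiveSpace n k).left), AlgebraicGeometry.IsClosedImmersion ι → AlgebraicGeometry.IsIntegral X → ∃ (Y H : AlgebraicGeometry.Scheme.{0}) (g : Y ⟶ AlgebraicGeometry.Spec (.of k)) (j : H ⟶ Y) (φ : X ⟶ H), AlgebraicGeometry.Smooth g ∧ AlgebraicGeometry.IsSeparated g ∧ AlgebraicGeometry.QuasiCompact g ∧ AlgebraicGeometry.IsClosedImmersion j ∧ AlgebraicGeometry.IsIntegral H ∧ (∀ y : Y, ∃ U : Y.affineOpens, y ∈ (U : Y.Opens) ∧ (j.ker.ideal U).IsPrincipal) ∧ AlgebraicGeometry.IsFinite φ ∧ Literature.AlgebraicGeometry.Resolution.IsBirational φ :=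
  hypersurfaceModel_infinite_of_stubs stub_functionFieldKaehler stub_formFnLinearGenerates
    stub_genericFormsNoCommonZero

end Summit.ResolutionOfSingularities.ResolutionOfSingularities.Theorems.WeightedThesis.HypersurfaceModel

end
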